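import Summits.ABC.IUTFork.Conditional.WRowFrey343Packages
import HarnessLib

/-!
# R-W WINDOW-TABLE, W1 ROW DECISION (inhabited side), UNCONDITIONAL: the known abc triple `7³ + 3¹⁰ = 2¹¹·29` at `l = 29`
# — the hull licence S_H HOLDS at EVERY genuine Θ-volume datum over `(ratPoint (343/59392), 29)`, with NO local-type hypothesis

PROOF-ONLY file (D-0012; 0 definitions, 0 `Prop` facts) of the abc-iut cell — D-0079 RESCUE sub-cell R-W «WINDOW Θ-SIDE INEQUALITY», lane P+
«prove S_H per datum», seat abc-iut-w4-d094 (gen 7); row 5 of HOME/plan/rescue/R-W/OPEN-10.md (sha16 1b0025ee7a8ba6d7, abc-iut-rw-num-lead):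
`pilotDataOfK:frey-343-59049-59392:29` (bad primes `3` — WILD, `3 ∣ e` — and `7`; `l⋆ = 14`). Built over abc-iut-W-row-1's socket
`Cor312Prov.licence_settingPrVolSharp_pilotDataOfK_of_orders_rat` (`Cor312LicenceWildInhabitedGenuineK`, itself over abc-iut-w4-d036's exact
wild cell p460046/p460573 and abc-iut-c312-5's T2 content theorem), abc-iut-W-row-2's conjugate-fibre lemma
(`Cor312LicenceWildInhabitedTriple`), and the local-type LOWER bounds of abc-iut-W-neg-1 / abc-iut-W-neg-2
(`Cor312GenuineKWildLowerBound`, `Cor312GenuineKCyclotomicLowerBound`). TAKES NO SIDE on [IUTchIII] Cor. 3.12 (S. Mochizuki, *Inter-universal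
Teichmüller theory III*, Cor. 3.12 p. 173–174; Step (xi-f) p. 184) or on any author; «inhabited as typed» ≠ «asserted in print».

WHAT IS NEW VERSUS ROWS 1–4 (abc-iut-W-row-1's `WRow.licence_frey283_*`, which carry the TABULATED local type and the conjugacy of the bad fibre
as hypotheses): here EVERY local input is DERIVED, so the row theorem is a bare `∀ T`.
* The ramification index at a bad prime is NOT pinned; it is an unknown natural number `e_p`, UNIFORM over the bad fibre because the bad
  completions over `p` are ISOMETRICALLY `ℚ_p`-isomorphic (`K/F_mod` Galois, `[F_mod : ℚ] = 1`; `WRowFrey343Packages` §2), and constrained only from BELOW: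
  `29 ∣ e_p` (the `l`-division layer over a pole, abc-iut-W-neg-1 `GenuineK.prime_dvd_absRamificationIdx_kOf_ratPoint`), and at `p = 3` moreover
  `2 ∣ e₃` (`μ₃ ⊆ F`, abc-iut-W-neg-2 `GenuineK.sub_one_dvd_absRamificationIdx_kOf`) and `87 ∣ e₃` (the `30`-th root of the Tate parameter in
  `F_w`, `ord₃ j = −20`: `GenuineK.thirty_mul_prime_dvd_absRamificationIdx_kOf_mul_three`) — so `e₃ ∈ 174·ℕ`, `e₇ ∈ 29·ℕ`.
* The integer cells of the socket are then proved for EVERY such `e` SYMBOLICALLY (`WRowFrey343Packages` §1): with the cheap one-sided shell data `D = e − 1`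
  ([IUTchIV] Prop. 1.3 (i)), `ρin = 1` (the unit ball is never inside `log_p(𝒪^×)`, abc-iut-W-row-1/W-row-2), and an outer member
  `log_p(1+ϖ)` of norm `≥ p^{−(p^a − a·e)/e}` for TWO fixed exponents `a` (abc-iut-c312-3's envelope; `min` of the two, `WRowFrey343Packages` §2), the cell
  `e·⌊(j²P − j(e−1) − (j+1))/e⌋ + (j+1)·ρout ≤ P` (`P₃ = 10e/29`, `P₇ = 3e/29`) holds at every label `j ≤ 14` for all `e = 174n` resp.
  `e = 29n`, `n ≥ 1` (`omega` after dropping the floor; tightest case `e₃ = 174`, `j = 14`). For the record: at `e₃ ∈ {29, 58, 87, 116, 145}`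
  the top-label cell FAILS (e.g. `e = 58`: `403 > 20`) — the lower bounds are exactly what makes the row decidable without a pinned type.

WHAT IS PROVED (namespace `Summit.ABC.IUTFork.Conditional`): **`WRow.licence_frey343_twentynine`** — for EVERY genuine Θ-volume datum `T` at
`(ratPoint (343/59392), 29)` and EVERY pair of realising Θ- and q-ideles, abc-iut-c312-1's `Thm311ToCor312.Licence` HOLDS at
`settingPrVolSharp (pilotDataOfK T.D T.K) …`; **`WRow.exists_qPinned_and_hull_frey343_twentynine`** — hence branch C's «∃ ρ qK, QPinned ∧
PilotKummerCompatHull» (the per-datum S_H object of the window certificates' binder `hSHwBad`, p453137 / p450130) is INHABITED there.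
READING (neutral; numbers, not adjectives): at this Szpiro-BAD admissible-candidate row OUR typed hull clause holds at OUR sharp genuine
`K`-setting for the whole datum class — no number-level hypothesis is consumed at this datum. Admissibility / (P6) of `(ratPoint λ, 29)` and
NON-EMPTINESS of the datum type are NOT claimed. HONEST SCOPE: OUR sharp containers; STRONGER-THAN-PRINT hull reading; nothing about the printed
inequality or any author's intended hull; typed ≠ proved; instantiated ≠ endorsed; no abc claim.
[cite: Mochizuki2012, IUTchI Def. 3.1 (b),(c) pp. 61–62, Rmk. 3.1.5 p. 65, Ex. 3.2 (iv) p. 71; IUTchIII Cor. 3.12 Step (xi-f) p. 184; IUTchIV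
Prop. 1.1 p. 9, Prop. 1.2 (i)(ii) p. 10, Prop. 1.3 (i) p. 11, Prop. 1.4 (ii) p. 13, Cor. 2.2 (ii) proof (P5) p. 46]
[cite: DupuyHilado2025, §3.3, §3.4, §4.9, §4.12] [cite: NeukirchANT1999, Ch. II (5.5)] [cite: CasselsFrohlichANT1967, Ch. VII Prop. 1.2 (ii)]
[claim: Mochizuki2012, status: disputed] for every IUT sentence.
-/

noncomputable section

open Set Function Metric NumberField IsDedekindDomain

namespace Summit.ABC.IUTFork.Conditional

open Thm311 Thm311.Real Cor312 Cor312Vol Cor312Prov Literature.IUT.LogThetaLattice Literature.IUT.LogVolume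
  Literature.IUT.HodgeTheaters Literature.IUT.LogVolume.Cor22
open Literature.NumberTheory.NumberFields Literature.NumberTheory.GaloisRepresentations.Ultrametric
open Literature.NumberTheory.DiophantineGeometry Literature.NumberTheory.DiophantineGeometry.GenEll

/-! ## THE ROW: S_H INHABITED at every genuine datum over `(ratPoint (343/59392), 29)` — unconditionally -/

/-- **W1 ROW DECISION, INHABITED SIDE, UNCONDITIONAL — `7³ + 3¹⁰ = 2¹¹·29` at `l = 29`.** For EVERY genuine Θ-volume datum `T` at
`(ratPoint (343/59392), 29)` ([IUTchIV] Cor. 2.2 (ii) proof (P7)) and EVERY pair of Θ- and q-ideles realising the pilot divisors of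
`X := pilotDataOfK T.D T.K`, abc-iut-c312-1's `Thm311ToCor312.Licence` HOLDS at abc-iut-c312-7's `settingPrVolSharp X …`. NO local-type and NO
conjugacy hypothesis: the bad primes are `3, 7` (`WRowFrey343Packages` §3); the bad completions over each are isometrically `ℚ_p`-isomorphic (`d_mod = 1`, ibid. §2), so the
ramification index is a single unknown `e_p` per prime with `174 ∣ e₃` (`29` from the `l`-division layer, `2` from `μ₃ ⊆ F`, `3` from the Tate
root over `3`) and `29 ∣ e₇`; the socket's one-sided inputs are `D = e − 1`, `ρin = 1`, `ρout = min(p^a − a·e, p^b − b·e)` (`(a,b) = (4,5)` at `3`,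
`(1,2)` at `7`), `h = 2·v_p(abc)`; the integer cells hold for every such `e` (ibid. §1). [cite: Mochizuki2012, IUTchIII Cor. 3.12 Step (xi-f) p. 184;
IUTchIV Prop. 1.1 p. 9, Prop. 1.2 (i)(ii) p. 10, Cor. 2.2 (ii) p. 46] [cite: DupuyHilado2025, §3.3, §3.4, §4.9, §4.12] [claim: Mochizuki2012, status: disputed] -/
theorem WRow.licence_frey343_twentynine (T : Cor22.ThetaVolumeDatumAt (ratPoint ((343 : ℚ) / 59392)) 29) :
    letI := T.instFieldF; letI := T.instNumberFieldF; letI := T.instAlgebraF; letI := T.instFieldK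
    letI := T.instNumberFieldK; letI := T.instAlgebraK; letI := T.instFieldFbar; letI := T.instAlgebraFbar
    letI := T.instAlgebraKFbar; letI := T.instIsElliptic
    ∀ {logv : PadicLogs T.K} (hlog : LogvAnalytic logv) (M : Type) [Field M] [NumberField M]
      (archPk : ∀ (j : (thetaIndex (pilotDataOfK T.D T.K)).Label) (vQ : (thetaIndex (pilotDataOfK T.D T.K)).VQ),
        Set ((logShellsDH (pilotDataOfK T.D T.K) logv).Packet j vQ))
      (archSub : ∀ (j : (thetaIndex (pilotDataOfK T.D T.K)).Label) (v : (thetaIndex (pilotDataOfK T.D T.K)).V),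
        Set ((logShellsDH (pilotDataOfK T.D T.K) logv).Packet j ((thetaIndex (pilotDataOfK T.D T.K)).over v)))
      (Ψ : ℤ → ∀ v : (thetaIndex (pilotDataOfK T.D T.K)).V, v ∈ (thetaIndex (pilotDataOfK T.D T.K)).Vbad →
        Set ((logShellsDH (pilotDataOfK T.D T.K) logv).StarPacket v))
      (act : ℤ → ∀ v : (thetaIndex (pilotDataOfK T.D T.K)).V, v ∈ (thetaIndex (pilotDataOfK T.D T.K)).Vbad →
        (logShellsDH (pilotDataOfK T.D T.K) logv).StarPacket v → Module.End ℚ ((logShellsDH (pilotDataOfK T.D T.K) logv).StarPacket v))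
      (Mmod : ℤ → ∀ j : (thetaIndex (pilotDataOfK T.D T.K)).LabelStar, Set ((logShellsDH (pilotDataOfK T.D T.K) logv).GlobalPacket j.1))
      (region : ℤ → ∀ j : (thetaIndex (pilotDataOfK T.D T.K)).LabelStar, FinDivisor M → ∀ vQ : (thetaIndex (pilotDataOfK T.D T.K)).VQ,
        Set ((logShellsDH (pilotDataOfK T.D T.K) logv).Packet j.1 vQ))
      (n : ℤ) {HT : Type} {LogLink : HT → HT → Type} {IsFull : ∀ {s t : HT}, LogLink s t → Prop}
      (lat : LGPGaussianLogThetaLattice LogLink IsFull)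
      {Frd : Type} {IsoF : Frd → Frd → Type} {Ob : Frd → Type} {realify : Frd → Frd} {Strip : Type}
      {IsoS : Strip → Strip → Type} {Mv : ∀ v : (thetaIndex (pilotDataOfK T.D T.K)).V, v ∈ (thetaIndex (pilotDataOfK T.D T.K)).Vbad → Type}
      [∀ v h, Monoid (Mv v h)]
      (sig : GlobalLGPFrobenioidSignature (thetaIndex (pilotDataOfK T.D T.K)).lstar (thetaIndex (pilotDataOfK T.D T.K)).V
        (· ∈ (thetaIndex (pilotDataOfK T.D T.K)).Vbad) Frd IsoF Ob realify Strip IsoS Mv)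
      (split : SplittingMonoids Mv) {ObΔ : Type} {N : ∀ v : (thetaIndex (pilotDataOfK T.D T.K)).V, v ∈ (thetaIndex (pilotDataOfK T.D T.K)).Vbad → Type}
      [∀ v h, Monoid (N v h)] (qData : QPilotData ObΔ N)
      (tq : ∀ (pp : Nat.Primes) (x : (thetaIndex (pilotDataOfK T.D T.K)).Fibre (.inr pp)),
        haveI : Fact (pp : ℕ).Prime := ⟨pp.2⟩; kOf (pilotDataOfK T.D T.K) pp.1 x)
      (t : ∀ (pp : Nat.Primes) (_ : Fin (pilotDataOfK T.D T.K).lstar) (x : (thetaIndex (pilotDataOfK T.D T.K)).Fibre (.inr pp)),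
        haveI : Fact (pp : ℕ).Prime := ⟨pp.2⟩; kOf (pilotDataOfK T.D T.K) pp.1 x)
      (htq0 : ∀ pp x, tq pp x ≠ 0)
      (htq1 : ∀ (pp : Nat.Primes) (x : (thetaIndex (pilotDataOfK T.D T.K)).Fibre (.inr pp)),
        haveI : Fact (pp : ℕ).Prime := ⟨pp.2⟩; placeOf (pilotDataOfK T.D T.K) pp.1 x ∉ (pilotDataOfK T.D T.K).S → ‖tq pp x‖ = 1)
      (_ht0 : ∀ pp i x, t pp i x ≠ 0)
      (_ht : ∀ (pp : Nat.Primes) (i : Fin (pilotDataOfK T.D T.K).lstar) (x : (thetaIndex (pilotDataOfK T.D T.K)).Fibre (.inr pp)),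
        haveI : Fact (pp : ℕ).Prime := ⟨pp.2⟩
        Real.log ‖t pp i x‖ = -((pilotDataOfK T.D T.K).thetaPilot i (placeOf (pilotDataOfK T.D T.K) pp.1 x)) *
          logNorm T.K (placeOf (pilotDataOfK T.D T.K) pp.1 x) / localDegree T.K (placeOf (pilotDataOfK T.D T.K) pp.1 x))
      (_htq : ∀ (pp : Nat.Primes) (x : (thetaIndex (pilotDataOfK T.D T.K)).Fibre (.inr pp)),
        haveI : Fact (pp : ℕ).Prime := ⟨pp.2⟩
        Real.log ‖tq pp x‖ = -((pilotDataOfK T.D T.K).qPilot (placeOf (pilotDataOfK T.D T.K) pp.1 x)) *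
          logNorm T.K (placeOf (pilotDataOfK T.D T.K) pp.1 x) / localDegree T.K (placeOf (pilotDataOfK T.D T.K) pp.1 x)),
      Thm311ToCor312.Licence
        (settingPrVolSharp (pilotDataOfK T.D T.K) hlog M archPk archSub Ψ act Mmod region n lat sig split qData tq t htq0 htq1) := by
  classical
  letI := T.instFieldF; letI := T.instNumberFieldF; letI := T.instAlgebraF; letI := T.instFieldK
  letI := T.instNumberFieldK; letI := T.instAlgebraK; letI := T.instFieldFbar; letI := T.instAlgebraFbar
  letI := T.instAlgebraKFbar; letI := T.instIsElliptic
  intro logv hlog M _ _ archPk archSub Ψ act Mmod region n HT LogLink IsFull lat Frd IsoF Ob realify Strip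
    IsoS Mv _ sig split ObΔ N _ qData tq t htq0 htq1 ht0 ht htq
  have hjF : T.E.j = ((jInv ((343 : ℚ) / 59392) : ℚ) : T.F) := by rw [T.j_eq]; exact eq_ratCast _ _
  have hlstar : (pilotDataOfK T.D T.K).lstar = 14 := by
    show ((pilotDataOfK T.D T.K).l - 1) / 2 = 14
    rw [pilotDataOfK_l]
  -- `d_mod = 1`: conjugate, isometric bad fibres
  have hFm : Module.finrank ℚ (fieldOfModuli T.E) = 1 := by
    rw [T.finrank_rat_fieldOfModuli_eq_dmod]
    exact dmod_eq_one_of_degree_le_one (by rw [degree_ratPoint])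
  -- poles of `j` at `3` and `7` (place form)
  have hpole3 : ∀ v : HeightOneSpectrum (𝓞 ℚ), Rat.HeightOneSpectrum.natGenerator v = ((⟨3, Nat.prime_three⟩ : Nat.Primes) : ℕ) →
      ord ℚ v (jInv ((343 : ℚ) / 59392)) = -(2 * ((10 : ℕ) : ℤ)) := fun v hv => by
    rw [WRow.ord_jInv_frey343 v hv (by norm_num)]; norm_num
  have hpole3' : ∀ v : HeightOneSpectrum (𝓞 ℚ), Rat.HeightOneSpectrum.natGenerator v = 3 →
      ord ℚ v (jInv ((343 : ℚ) / 59392)) < 0 := fun v hv => by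
    rw [WRow.ord_jInv_frey343 v hv (by norm_num)]; norm_num
  have hpole7 : ∀ v : HeightOneSpectrum (𝓞 ℚ), Rat.HeightOneSpectrum.natGenerator v = 7 →
      ord ℚ v (jInv ((343 : ℚ) / 59392)) < 0 := fun v hv => by
    rw [WRow.ord_jInv_frey343 v hv (by norm_num)]; norm_num
  -- the per-prime data (e, D, h, ρin, ρout): `e` is the ACTUAL (unknown) index at some bad fibre point
  set eF : Nat.Primes → ℕ := fun pp =>
    haveI : Fact (pp : ℕ).Prime := ⟨pp.2⟩
    if h : ∃ x : (thetaIndex (pilotDataOfK T.D T.K)).Fibre (.inr pp), placeOf (pilotDataOfK T.D T.K) pp.1 x ∈ (pilotDataOfK T.D T.K).S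
    then absRamificationIdx (pp : ℕ) (kOf (pilotDataOfK T.D T.K) pp.1 h.choose) else 1 with heF
  set DF : Nat.Primes → ℕ := fun pp => eF pp - 1 with hDF
  set hF : Nat.Primes → ℕ := fun pp => if (pp : ℕ) = 3 then 20 else if (pp : ℕ) = 7 then 6 else 2 with hhF
  set rinF : Nat.Primes → ℤ := fun _ => 1 with hrinF
  set routF : Nat.Primes → ℤ := fun pp => if (pp : ℕ) = 3
    then min ((3 : ℤ) ^ 4 - 4 * (eF pp : ℤ)) ((3 : ℤ) ^ 5 - 5 * (eF pp : ℤ))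
    else min ((7 : ℤ) ^ 1 - 1 * (eF pp : ℤ)) ((7 : ℤ) ^ 2 - 2 * (eF pp : ℤ)) with hroutF
  -- at a bad fibre point `x | p`: `e(K_x) = eF p`
  have heq : ∀ (pp : Nat.Primes) (x : (thetaIndex (pilotDataOfK T.D T.K)).Fibre (.inr pp)),
      haveI : Fact (pp : ℕ).Prime := ⟨pp.2⟩
      placeOf (pilotDataOfK T.D T.K) pp.1 x ∈ (pilotDataOfK T.D T.K).S →
        absRamificationIdx (pp : ℕ) (kOf (pilotDataOfK T.D T.K) pp.1 x) = eF pp := by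
    intro pp x hx
    haveI : Fact (pp : ℕ).Prime := ⟨pp.2⟩
    have hex : ∃ x : (thetaIndex (pilotDataOfK T.D T.K)).Fibre (.inr pp),
        placeOf (pilotDataOfK T.D T.K) pp.1 x ∈ (pilotDataOfK T.D T.K).S := ⟨x, hx⟩
    have h1 : eF pp = absRamificationIdx (pp : ℕ) (kOf (pilotDataOfK T.D T.K) pp.1 hex.choose) := by
      simp only [heF, dif_pos hex]
    rw [h1]
    exact WRow.absRamificationIdx_kOf_eq_of_finrank_eq_one T.D hFm pp x hex.choose
  -- divisibilities of `e` at the two bad primes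
  have h174 : ∀ (pp : Nat.Primes) (x : (thetaIndex (pilotDataOfK T.D T.K)).Fibre (.inr pp)),
      haveI : Fact (pp : ℕ).Prime := ⟨pp.2⟩
      placeOf (pilotDataOfK T.D T.K) pp.1 x ∈ (pilotDataOfK T.D T.K).S → (pp : ℕ) = 3 → ∃ m : ℕ, 1 ≤ m ∧ eF pp = 174 * m := by
    intro pp x hx hp3
    haveI : Fact (pp : ℕ).Prime := ⟨pp.2⟩
    have hpp : pp = ⟨3, Nat.prime_three⟩ := Subtype.ext hp3
    subst hpp
    have hE := heq _ x hx
    have h29 : 29 ∣ absRamificationIdx 3 (kOf (pilotDataOfK T.D T.K) 3 x) :=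
      GenuineK.prime_dvd_absRamificationIdx_kOf_ratPoint T ⟨3, Nat.prime_three⟩ (by norm_num) (by norm_num) hpole3' x
    have h2 : (3 - 1) ∣ absRamificationIdx 3 (kOf (pilotDataOfK T.D T.K) 3 x) :=
      GenuineK.sub_one_dvd_absRamificationIdx_kOf T ⟨3, Nat.prime_three⟩ (by norm_num) x
    have h870 : 30 * 29 ∣ absRamificationIdx 3 (kOf (pilotDataOfK T.D T.K) 3 x) * 10 :=
      GenuineK.thirty_mul_prime_dvd_absRamificationIdx_kOf_mul_three T (by norm_num) (t := 10) (by norm_num) hpole3 x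
    have hpos := absRamificationIdx_pos 3 (kOf (pilotDataOfK T.D T.K) 3 x)
    rw [hE] at h29 h2 h870 hpos
    refine ⟨eF ⟨3, Nat.prime_three⟩ / 174, ?_, ?_⟩ <;> omega
  have h29' : ∀ (pp : Nat.Primes) (x : (thetaIndex (pilotDataOfK T.D T.K)).Fibre (.inr pp)),
      haveI : Fact (pp : ℕ).Prime := ⟨pp.2⟩
      placeOf (pilotDataOfK T.D T.K) pp.1 x ∈ (pilotDataOfK T.D T.K).S → (pp : ℕ) = 7 → ∃ m : ℕ, 1 ≤ m ∧ eF pp = 29 * m := by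
    intro pp x hx hp7
    haveI : Fact (pp : ℕ).Prime := ⟨pp.2⟩
    have hE := heq _ x hx
    have h29 : 29 ∣ absRamificationIdx (pp : ℕ) (kOf (pilotDataOfK T.D T.K) pp.1 x) :=
      GenuineK.prime_dvd_absRamificationIdx_kOf_ratPoint T pp (by rw [hp7]; norm_num) (by rw [hp7]; norm_num)
        (fun v hv => hpole7 v (by rw [hv, hp7])) x
    have hpos := absRamificationIdx_pos (pp : ℕ) (kOf (pilotDataOfK T.D T.K) pp.1 x)
    rw [hE] at h29 hpos
    refine ⟨eF pp / 29, ?_, ?_⟩ <;> omega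
  -- `e` is off the cyclotomic indices at both primes (`29 ∣ e`)
  have hne : ∀ (p₀ e : ℕ), (p₀ = 3 ∨ p₀ = 7) → 29 ∣ e → ∀ c : ℕ, (e : ℤ) ≠ (p₀ : ℤ) ^ c * ((p₀ : ℤ) - 1) := by
    intro p₀ e hp hdvd c h
    have hp₀ : p₀.Prime := by rcases hp with rfl | rfl <;> norm_num
    have h1 : 1 ≤ p₀ := hp₀.one_lt.le
    have h' : e = p₀ ^ c * (p₀ - 1) := by
      have : (e : ℤ) = ((p₀ ^ c * (p₀ - 1) : ℕ) : ℤ) := by rw [h]; push_cast; rw [Nat.cast_sub h1, Nat.cast_one]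
      exact_mod_cast this
    rw [h'] at hdvd
    have h29p : Nat.Prime 29 := by norm_num
    rcases (Nat.Prime.dvd_mul h29p).mp hdvd with h | h
    · have := (Nat.prime_dvd_prime_iff_eq h29p hp₀).mp (h29p.dvd_of_dvd_pow h)
      rcases hp with rfl | rfl <;> omega
    · rcases hp with rfl | rfl <;> omega
  refine Cor312Prov.licence_settingPrVolSharp_pilotDataOfK_of_orders_rat T.D hlog M archPk archSub Ψ act Mmod region n lat sig split qData
    tq t htq0 htq1 ht0 ht htq (jInv ((343 : ℚ) / 59392)) hjF eF DF hF rinF routF (fun pp x hx => ?_)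
    (fun pp x y _ _ => Cor312Prov.nonempty_algEquiv_kOf_of_finrank_eq_one T.D hFm pp x y) (fun pp hpp i => ?_)
  · -- the local packages at a bad place `x | p`
    haveI : Fact (pp : ℕ).Prime := ⟨pp.2⟩
    have hE := heq pp x hx
    rcases WRow.bad_prime_frey343 T pp x hx with ⟨hp, hord⟩ | ⟨hp, hord⟩
    · obtain ⟨m, hm1, hm⟩ := h174 pp x hx hp
      have h3 : hF pp = 20 := by simp [hhF, hp]
      have h4 : rinF pp = 1 := by simp [hrinF]
      have h5 : routF pp = min ((3 : ℤ) ^ 4 - 4 * (eF pp : ℤ)) ((3 : ℤ) ^ 5 - 5 * (eF pp : ℤ)) := by simp [hroutF, hp]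
      refine ⟨hE, Cor312Prov.pred_div_le_differentOrd_of_eq (pp : ℕ) hE, ?_, ?_, ?_, ?_⟩
      · rw [h4]; exact WRow.inner_witness_trivial (pp : ℕ) _ (eF pp)
      · rw [h5]
        have h := WRow.exists_mem_logUnits_rpow_min_le_norm (pp : ℕ) hE
          (hne (pp : ℕ) (eF pp) (Or.inl hp) ⟨6 * m, by rw [hm]; ring⟩) 4 5
        have hpz : ((pp : ℕ) : ℤ) = 3 := by exact_mod_cast hp
        have hmin : min (((pp : ℕ) : ℤ) ^ 4 - ((4 : ℕ) : ℤ) * (eF pp : ℤ)) (((pp : ℕ) : ℤ) ^ 5 - ((5 : ℕ) : ℤ) * (eF pp : ℤ)) =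
            min ((3 : ℤ) ^ 4 - 4 * (eF pp : ℤ)) ((3 : ℤ) ^ 5 - 5 * (eF pp : ℤ)) := by
          rw [hpz]; norm_num
        rw [hmin] at h
        exact h
      · rw [h3]; simpa using hord
      · rw [h3, hm]; omega
    · obtain ⟨m, hm1, hm⟩ := h29' pp x hx hp
      have h3 : hF pp = 6 := by simp [hhF, hp]
      have h4 : rinF pp = 1 := by simp [hrinF]
      have h5 : routF pp = min ((7 : ℤ) ^ 1 - 1 * (eF pp : ℤ)) ((7 : ℤ) ^ 2 - 2 * (eF pp : ℤ)) := by simp [hroutF, hp]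
      refine ⟨hE, Cor312Prov.pred_div_le_differentOrd_of_eq (pp : ℕ) hE, ?_, ?_, ?_, ?_⟩
      · rw [h4]; exact WRow.inner_witness_trivial (pp : ℕ) _ (eF pp)
      · rw [h5]
        have h := WRow.exists_mem_logUnits_rpow_min_le_norm (pp : ℕ) hE
          (hne (pp : ℕ) (eF pp) (Or.inr hp) ⟨m, by rw [hm]⟩) 1 2
        have hpz : ((pp : ℕ) : ℤ) = 7 := by exact_mod_cast hp
        have hmin : min (((pp : ℕ) : ℤ) ^ 1 - ((1 : ℕ) : ℤ) * (eF pp : ℤ)) (((pp : ℕ) : ℤ) ^ 2 - ((2 : ℕ) : ℤ) * (eF pp : ℤ)) =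
            min ((7 : ℤ) ^ 1 - 1 * (eF pp : ℤ)) ((7 : ℤ) ^ 2 - 2 * (eF pp : ℤ)) := by
          rw [hpz]; norm_num
        rw [hmin] at h
        exact h
      · rw [h3]; simpa using hord
      · rw [h3, hm]; omega
  · -- the integer cells at every label `j = i + 1 ≤ 14`
    haveI : Fact (pp : ℕ).Prime := ⟨pp.2⟩
    obtain ⟨x, hx⟩ := hpp
    have hi : (i : ℕ) < 14 := hlstar ▸ i.isLt
    generalize hk : (i : ℕ) = k at hi ⊢
    rcases WRow.bad_prime_frey343 T pp x hx with ⟨hp, -⟩ | ⟨hp, -⟩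
    · obtain ⟨m, hm1, hm⟩ := h174 pp x hx hp
      have h2 : DF pp = 174 * m - 1 := by simp [hDF, hm]
      have h3 : hF pp = 20 := by simp [hhF, hp]
      have h4 : rinF pp = 1 := by simp [hrinF]
      have h5 : routF pp = min ((3 : ℤ) ^ 4 - 4 * (eF pp : ℤ)) ((3 : ℤ) ^ 5 - 5 * (eF pp : ℤ)) := by simp [hroutF, hp]
      rw [h2, h3, h4, h5, hm]
      exact WRow.cell_frey343_three hm1 k hi
    · obtain ⟨m, hm1, hm⟩ := h29' pp x hx hp
      have h2 : DF pp = 29 * m - 1 := by simp [hDF, hm]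
      have h3 : hF pp = 6 := by simp [hhF, hp]
      have h4 : rinF pp = 1 := by simp [hrinF]
      have h5 : routF pp = min ((7 : ℤ) ^ 1 - 1 * (eF pp : ℤ)) ((7 : ℤ) ^ 2 - 2 * (eF pp : ℤ)) := by simp [hroutF, hp]
      rw [h2, h3, h4, h5, hm]
      exact WRow.cell_frey343_seven hm1 k hi

/-- **BRANCH C's PER-DATUM ANTECEDENT «∃ ρ qK, QPinned ∧ PilotKummerCompatHull» INHABITED at every genuine datum over `(ratPoint (343/59392), 29)`**
(any columns `col`; every pair of realising Θ- and q-ideles, the CHOSEN ones of the window certificates' `hSHw`/`hSHwBad` binders included —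
abc-iut-w5-d009's `exists_qPinned_and_hull_settingPrVolSharp_iff_licence`, realising q-ideles having norm `≤ 1`): the per-datum S_H object of the
certificates of record (p453137 / p450130 / p447945) HOLDS at this datum class, UNCONDITIONALLY — the R-W table's first W1 row decided by a bare
`∀ T` theorem. [cite: Mochizuki2012, IUTchIII Cor. 3.12 Step (xi-d) p. 183, (xi-f) p. 184] [cite: DupuyHilado2025, §3.3, §3.4, §4.9]
[claim: Mochizuki2012, status: disputed] -/
theorem WRow.exists_qPinned_and_hull_frey343_twentynine (T : Cor22.ThetaVolumeDatumAt (ratPoint ((343 : ℚ) / 59392)) 29) :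
    letI := T.instFieldF; letI := T.instNumberFieldF; letI := T.instAlgebraF; letI := T.instFieldK
    letI := T.instNumberFieldK; letI := T.instAlgebraK; letI := T.instFieldFbar; letI := T.instAlgebraFbar
    letI := T.instAlgebraKFbar; letI := T.instIsElliptic
    ∀ {logv : PadicLogs T.K} (hlog : LogvAnalytic logv) (M : Type) [Field M] [NumberField M]
      (archPk : ∀ (j : (thetaIndex (pilotDataOfK T.D T.K)).Label) (vQ : (thetaIndex (pilotDataOfK T.D T.K)).VQ),
        Set ((logShellsDH (pilotDataOfK T.D T.K) logv).Packet j vQ))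
      (archSub : ∀ (j : (thetaIndex (pilotDataOfK T.D T.K)).Label) (v : (thetaIndex (pilotDataOfK T.D T.K)).V),
        Set ((logShellsDH (pilotDataOfK T.D T.K) logv).Packet j ((thetaIndex (pilotDataOfK T.D T.K)).over v)))
      (Ψ : ℤ → ∀ v : (thetaIndex (pilotDataOfK T.D T.K)).V, v ∈ (thetaIndex (pilotDataOfK T.D T.K)).Vbad →
        Set ((logShellsDH (pilotDataOfK T.D T.K) logv).StarPacket v))
      (act : ℤ → ∀ v : (thetaIndex (pilotDataOfK T.D T.K)).V, v ∈ (thetaIndex (pilotDataOfK T.D T.K)).Vbad →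
        (logShellsDH (pilotDataOfK T.D T.K) logv).StarPacket v → Module.End ℚ ((logShellsDH (pilotDataOfK T.D T.K) logv).StarPacket v))
      (Mmod : ℤ → ∀ j : (thetaIndex (pilotDataOfK T.D T.K)).LabelStar, Set ((logShellsDH (pilotDataOfK T.D T.K) logv).GlobalPacket j.1))
      (region : ℤ → ∀ j : (thetaIndex (pilotDataOfK T.D T.K)).LabelStar, FinDivisor M → ∀ vQ : (thetaIndex (pilotDataOfK T.D T.K)).VQ,
        Set ((logShellsDH (pilotDataOfK T.D T.K) logv).Packet j.1 vQ))
      (n : ℤ) {HT : Type} {LogLink : HT → HT → Type} {IsFull : ∀ {s t : HT}, LogLink s t → Prop}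
      (lat : LGPGaussianLogThetaLattice LogLink IsFull)
      {Frd : Type} {IsoF : Frd → Frd → Type} {Ob : Frd → Type} {realify : Frd → Frd} {Strip : Type}
      {IsoS : Strip → Strip → Type} {Mv : ∀ v : (thetaIndex (pilotDataOfK T.D T.K)).V, v ∈ (thetaIndex (pilotDataOfK T.D T.K)).Vbad → Type}
      [∀ v h, Monoid (Mv v h)]
      (sig : GlobalLGPFrobenioidSignature (thetaIndex (pilotDataOfK T.D T.K)).lstar (thetaIndex (pilotDataOfK T.D T.K)).V
        (· ∈ (thetaIndex (pilotDataOfK T.D T.K)).Vbad) Frd IsoF Ob realify Strip IsoS Mv)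
      (split : SplittingMonoids Mv) {ObΔ : Type} {N : ∀ v : (thetaIndex (pilotDataOfK T.D T.K)).V, v ∈ (thetaIndex (pilotDataOfK T.D T.K)).Vbad → Type}
      [∀ v h, Monoid (N v h)] (qData : QPilotData ObΔ N)
      (tq : ∀ (pp : Nat.Primes) (x : (thetaIndex (pilotDataOfK T.D T.K)).Fibre (.inr pp)),
        haveI : Fact (pp : ℕ).Prime := ⟨pp.2⟩; kOf (pilotDataOfK T.D T.K) pp.1 x)
      (t : ∀ (pp : Nat.Primes) (_ : Fin (pilotDataOfK T.D T.K).lstar) (x : (thetaIndex (pilotDataOfK T.D T.K)).Fibre (.inr pp)),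
        haveI : Fact (pp : ℕ).Prime := ⟨pp.2⟩; kOf (pilotDataOfK T.D T.K) pp.1 x)
      (htq0 : ∀ pp x, tq pp x ≠ 0)
      (htq1 : ∀ (pp : Nat.Primes) (x : (thetaIndex (pilotDataOfK T.D T.K)).Fibre (.inr pp)),
        haveI : Fact (pp : ℕ).Prime := ⟨pp.2⟩; placeOf (pilotDataOfK T.D T.K) pp.1 x ∉ (pilotDataOfK T.D T.K).S → ‖tq pp x‖ = 1)
      (col : ℤ → Column (logShellsDH (pilotDataOfK T.D T.K) logv))
      (_ht0 : ∀ pp i x, t pp i x ≠ 0)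
      (_ht : ∀ (pp : Nat.Primes) (i : Fin (pilotDataOfK T.D T.K).lstar) (x : (thetaIndex (pilotDataOfK T.D T.K)).Fibre (.inr pp)),
        haveI : Fact (pp : ℕ).Prime := ⟨pp.2⟩
        Real.log ‖t pp i x‖ = -((pilotDataOfK T.D T.K).thetaPilot i (placeOf (pilotDataOfK T.D T.K) pp.1 x)) *
          logNorm T.K (placeOf (pilotDataOfK T.D T.K) pp.1 x) / localDegree T.K (placeOf (pilotDataOfK T.D T.K) pp.1 x))
      (_htq : ∀ (pp : Nat.Primes) (x : (thetaIndex (pilotDataOfK T.D T.K)).Fibre (.inr pp)),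
        haveI : Fact (pp : ℕ).Prime := ⟨pp.2⟩
        Real.log ‖tq pp x‖ = -((pilotDataOfK T.D T.K).qPilot (placeOf (pilotDataOfK T.D T.K) pp.1 x)) *
          logNorm T.K (placeOf (pilotDataOfK T.D T.K) pp.1 x) / localDegree T.K (placeOf (pilotDataOfK T.D T.K) pp.1 x)),
      ∃ (ρ : (∀ v : (thetaIndex (pilotDataOfK T.D T.K)).V, v ∈ (thetaIndex (pilotDataOfK T.D T.K)).Vbad →
              Set ((logShellsDH (pilotDataOfK T.D T.K) logv).StarPacket v)) →
            ∀ (j : (thetaIndex (pilotDataOfK T.D T.K)).Label) (vQ : (thetaIndex (pilotDataOfK T.D T.K)).VQ),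
              Set ((logShellsDH (pilotDataOfK T.D T.K) logv).Packet j vQ))
          (qK : ∀ v : (thetaIndex (pilotDataOfK T.D T.K)).V, v ∈ (thetaIndex (pilotDataOfK T.D T.K)).Vbad →
            Set ((logShellsDH (pilotDataOfK T.D T.K) logv).StarPacket v)),
          QPinned ({ toSituation := situationPrVol (pilotDataOfK T.D T.K) hlog M archPk archSub Ψ act Mmod region, col := col } :
              LatticeSituation (thetaIndex (pilotDataOfK T.D T.K)))
            (settingPrVolSharp (pilotDataOfK T.D T.K) hlog M archPk archSub Ψ act Mmod region n lat sig split qData tq t htq0 htq1) ρ qK ∧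
          PilotKummerCompatHull ({ toSituation := situationPrVol (pilotDataOfK T.D T.K) hlog M archPk archSub Ψ act Mmod region, col := col } :
              LatticeSituation (thetaIndex (pilotDataOfK T.D T.K)))
            (settingPrVolSharp (pilotDataOfK T.D T.K) hlog M archPk archSub Ψ act Mmod region n lat sig split qData tq t htq0 htq1) ρ qK := by
  letI := T.instFieldF; letI := T.instNumberFieldF; letI := T.instAlgebraF; letI := T.instFieldK
  letI := T.instNumberFieldK; letI := T.instAlgebraK; letI := T.instFieldFbar; letI := T.instAlgebraFbar
  letI := T.instAlgebraKFbar; letI := T.instIsElliptic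
  intro logv hlog M _ _ archPk archSub Ψ act Mmod region n HT LogLink IsFull lat Frd IsoF Ob realify Strip
    IsoS Mv _ sig split ObΔ N _ qData tq t htq0 htq1 col ht0 ht htq
  exact (exists_qPinned_and_hull_settingPrVolSharp_iff_licence (pilotDataOfK T.D T.K) hlog M archPk archSub Ψ act Mmod region n lat sig
    split qData tq t htq0 htq1 col (fun pp x => norm_qIdele_le_one_of_realises (pilotDataOfK T.D T.K) tq htq0 htq pp x)).2
    (WRow.licence_frey343_twentynine T hlog M archPk archSub Ψ act Mmod region n lat sig split qData tq t htq0 htq1 ht0 ht htq)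

end Summit.ABC.IUTFork.Conditional

end
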